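import Mathlib
import Summits.ResolutionOfSingularities.ResolutionOfSingularities.Theorems.HomologicalConductorPersistenceKC3Normal
import Summits.ResolutionOfSingularities.ResolutionOfSingularities.Theorems.HomologicalConductorPersistenceKC3TowerInstance
import Summits.ResolutionOfSingularities.ResolutionOfSingularities.Theorems.SyzygyFlatteningRankOneTerminationStageNormal
import Summits.ResolutionOfSingularities.ResolutionOfSingularities.Theorems.SyzygyFlatteningHigherRankTerminationRegularStep
import HarnessLib

/-!
# Crux `Persistence` (stmt-ResolutionOfSingularities-16484), KILL CANDIDATE K-C3, piece K3b-N (cone side):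
# `nrm (loc O W) = loc O W` for the `x`-chart `W`, and the K-C3 TOWER STEP with normality DISCHARGED

Route `ResolutionOfSingularities/HomologicalConductor`, chain w44b (CHAIN v13.2 §V13.10; REFEREE-KC3 934cc3b7642bc99f L5–L6).
[OURS · L1 w44b] — AI-written, weaker than expert review; not a statement of any manuscript under review; no theorem here
concludes the crux.

`K := FractionRing (MvPolynomial (Fin 3) k) = k(x,z,t)`, `x z t := X 0, X 1, X 2`,
`W := k[x, z, t, z²x⁻¹, ztx⁻¹, t²x⁻¹, z³x⁻¹x⁻¹]`, `A := k[x, z, t, (z³+t⁴)x⁻¹]` (spelled exactly as in res-D-pv-043's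
`…PersistenceKC3TowerInstance.kc3_tower_one_eq`, p528915), `loc/nrm/tower/ca` the route vocabulary of
`…HomologicalConductorNoZenoBirthDefs`.

* `isIntegrallyClosed_loc_W` — for every valuation ring `O ⊇ W` of `K`, `loc O W` is integrally closed
  (`…PersistenceKC3Normal.isIntegrallyClosed_W` + `SyzygyFlattening.isIntegrallyClosed_locAt`, `loc = locAt` by `rfl`);
* `nrm_loc_W_eq` / `nrm_loc_W_le` — **`nrm (loc O W) = loc O W`**: the hypothesis `hnrm` of `kc3_tower_one_eq`, DISCHARGED;
* `kc3_tower_one_eq_of_ca` — **`tower O A 1 = loc O W`** for every valuation ring `O ⊇ W` of `k(x,z,t)`, conditional ONLY on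
  `hca : ca (loc O A) = (x, y, z², zt, t²)·loc O A` (the F-DP/U2 input of the chain, K2).

References: W. Bruns, J. Herzog, *Cohen–Macaulay rings*, CUP 1998 (rev. ed.), Prop. 6.1.2 [BrunsHerzog1998]; M. F. Atiyah,
I. G. Macdonald, *Introduction to Commutative Algebra*, Prop. 5.12 [AtiyahMacdonald1969].
-/

-- single-problem summit: the doubled namespace component `ResolutionOfSingularities` is forced
set_option linter.dupNamespace false

noncomputable section

namespace Summit.ResolutionOfSingularities.ResolutionOfSingularities.Theorems.HomologicalConductor.PersistenceKC3NormalLoc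

open Summit.ResolutionOfSingularities.ResolutionOfSingularities.Theorems
open Summit.ResolutionOfSingularities.ResolutionOfSingularities.Theorems.NoZeno.Birth
open Summit.ResolutionOfSingularities.ResolutionOfSingularities.Theorems.HomologicalConductor.PersistenceKC3ChartClosedForm
open Summit.ResolutionOfSingularities.ResolutionOfSingularities.Theorems.HomologicalConductor.PersistenceKC3Normal

variable {k : Type} [Field k]

local notation3 "𝕂" => FractionRing (MvPolynomial (Fin 3) k)
local notation3 "𝔵" => algebraMap (MvPolynomial (Fin 3) k) (FractionRing (MvPolynomial (Fin 3) k)) (MvPolynomial.X 0)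
local notation3 "𝔷" => algebraMap (MvPolynomial (Fin 3) k) (FractionRing (MvPolynomial (Fin 3) k)) (MvPolynomial.X 1)
local notation3 "𝔱" => algebraMap (MvPolynomial (Fin 3) k) (FractionRing (MvPolynomial (Fin 3) k)) (MvPolynomial.X 2)
/-- `W = k[x, z, t, z²x⁻¹, ztx⁻¹, t²x⁻¹, z³x⁻¹x⁻¹] ⊆ k(x,z,t)`, spelled as in `kc3_tower_one_eq` (local notation only). -/
local notation3 "𝕎" => Algebra.adjoin k
  ({algebraMap (MvPolynomial (Fin 3) k) (FractionRing (MvPolynomial (Fin 3) k)) (MvPolynomial.X 0),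
    algebraMap (MvPolynomial (Fin 3) k) (FractionRing (MvPolynomial (Fin 3) k)) (MvPolynomial.X 1),
    algebraMap (MvPolynomial (Fin 3) k) (FractionRing (MvPolynomial (Fin 3) k)) (MvPolynomial.X 2),
    algebraMap (MvPolynomial (Fin 3) k) (FractionRing (MvPolynomial (Fin 3) k)) (MvPolynomial.X 1) ^ 2 *
      (algebraMap (MvPolynomial (Fin 3) k) (FractionRing (MvPolynomial (Fin 3) k)) (MvPolynomial.X 0))⁻¹,
    algebraMap (MvPolynomial (Fin 3) k) (FractionRing (MvPolynomial (Fin 3) k)) (MvPolynomial.X 1) *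
      algebraMap (MvPolynomial (Fin 3) k) (FractionRing (MvPolynomial (Fin 3) k)) (MvPolynomial.X 2) *
      (algebraMap (MvPolynomial (Fin 3) k) (FractionRing (MvPolynomial (Fin 3) k)) (MvPolynomial.X 0))⁻¹,
    algebraMap (MvPolynomial (Fin 3) k) (FractionRing (MvPolynomial (Fin 3) k)) (MvPolynomial.X 2) ^ 2 *
      (algebraMap (MvPolynomial (Fin 3) k) (FractionRing (MvPolynomial (Fin 3) k)) (MvPolynomial.X 0))⁻¹,
    algebraMap (MvPolynomial (Fin 3) k) (FractionRing (MvPolynomial (Fin 3) k)) (MvPolynomial.X 1) ^ 3 *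
      (algebraMap (MvPolynomial (Fin 3) k) (FractionRing (MvPolynomial (Fin 3) k)) (MvPolynomial.X 0))⁻¹ *
      (algebraMap (MvPolynomial (Fin 3) k) (FractionRing (MvPolynomial (Fin 3) k)) (MvPolynomial.X 0))⁻¹} :
    Set (FractionRing (MvPolynomial (Fin 3) k)))
/-- `A = k[x, z, t, (z³+t⁴)x⁻¹] ⊆ k(x,z,t)` (the cusp threefold `xy = z³ + t⁴`), spelled as in `kc3_tower_one_eq`
(local notation only). -/
local notation3 "𝔸" => Algebra.adjoin k
  ({algebraMap (MvPolynomial (Fin 3) k) (FractionRing (MvPolynomial (Fin 3) k)) (MvPolynomial.X 0),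
    algebraMap (MvPolynomial (Fin 3) k) (FractionRing (MvPolynomial (Fin 3) k)) (MvPolynomial.X 1),
    algebraMap (MvPolynomial (Fin 3) k) (FractionRing (MvPolynomial (Fin 3) k)) (MvPolynomial.X 2),
    (algebraMap (MvPolynomial (Fin 3) k) (FractionRing (MvPolynomial (Fin 3) k)) (MvPolynomial.X 1) ^ 3 +
        algebraMap (MvPolynomial (Fin 3) k) (FractionRing (MvPolynomial (Fin 3) k)) (MvPolynomial.X 2) ^ 4) *
      (algebraMap (MvPolynomial (Fin 3) k) (FractionRing (MvPolynomial (Fin 3) k)) (MvPolynomial.X 0))⁻¹} :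
    Set (FractionRing (MvPolynomial (Fin 3) k)))

/-- `W ⊆ O` as subrings, from the set inclusion. [folklore] -/
theorem W_toSubring_le (O : ValuationSubring 𝕂) (hWO : ((𝕎 : Subalgebra k 𝕂) : Set 𝕂) ⊆ O) :
    (𝕎 : Subalgebra k 𝕂).toSubring ≤ O.toSubring := fun _ hy => hWO hy

/-- **`loc O W` is integrally closed** for every valuation ring `O ⊇ W` of `K = k(x,z,t)`: `W` is a normal domain
(`isIntegrallyClosed_W`) and localisation at the centre of `O` preserves normality
(`SyzygyFlattening.isIntegrallyClosed_locAt`; `loc = locAt` by `rfl`). [cite: BrunsHerzog1998, Prop. 6.1.2]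
[cite: AtiyahMacdonald1969, Prop. 5.12] -/
theorem isIntegrallyClosed_loc_W (O : ValuationSubring 𝕂) (hWO : ((𝕎 : Subalgebra k 𝕂) : Set 𝕂) ⊆ O) :
    IsIntegrallyClosed ↥(loc O (𝕎 : Subalgebra k 𝕂)) := by
  haveI := isIntegrallyClosed_W (k := k)
  rw [loc_eq_locAt]
  exact SyzygyFlattening.isIntegrallyClosed_locAt O _ (W_toSubring_le O hWO)

/-- `Frac (loc O W) = K`. [folklore] -/
theorem isFractionRing_loc_W (O : ValuationSubring 𝕂) : IsFractionRing ↥(loc O (𝕎 : Subalgebra k 𝕂)) 𝕂 := by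
  haveI := isFractionRing_W (k := k)
  rw [loc_eq_locAt]
  exact Literature.AlgebraicGeometry.Resolution.isFractionRing_subalgebra_of_le _ _
    (SyzygyFlattening.self_le_locAt O _)

/-- **`nrm (loc O W) = loc O W`**: the localised chart is its own normalisation inside `K` (REFEREE-KC3 L5).
[cite: BrunsHerzog1998, Prop. 6.1.2] -/
theorem nrm_loc_W_eq (O : ValuationSubring 𝕂) (hWO : ((𝕎 : Subalgebra k 𝕂) : Set 𝕂) ⊆ O) :
    nrm (loc O (𝕎 : Subalgebra k 𝕂)) = loc O (𝕎 : Subalgebra k 𝕂) := by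
  haveI := isIntegrallyClosed_loc_W O hWO
  haveI := isFractionRing_loc_W (k := k) O
  rw [nrm_eq_nrm]
  exact SyzygyFlattening.nrm_eq_self_of_isIntegrallyClosed _

/-- **The hypothesis `hnrm` of `kc3_tower_one_eq`, DISCHARGED**: `nrm (loc O W) ≤ loc O W` for every valuation ring
`O ⊇ W` of `k(x,z,t)`. [cite: BrunsHerzog1998, Prop. 6.1.2] -/
theorem nrm_loc_W_le (O : ValuationSubring 𝕂) (hWO : ((𝕎 : Subalgebra k 𝕂) : Set 𝕂) ⊆ O) :
    nrm (loc O (𝕎 : Subalgebra k 𝕂)) ≤ loc O (𝕎 : Subalgebra k 𝕂) :=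
  (nrm_loc_W_eq O hWO).le

/-- **THE K-C3 TOWER STEP WITH NORMALITY DISCHARGED** (REFEREE-KC3 L3–L6; res-D-pv-043's `kc3_tower_one_eq` p528915 at
the K-C3 instance `K = k(x,z,t)`, `x z t` the coordinate functions, with its hypothesis `hnrm` supplied by
`nrm_loc_W_le`): for every valuation ring `O` of `k(x,z,t)` containing `W = k[x,z,t,z²/x,zt/x,t²/x,z³/x²]`, IF
`ca (loc O A) = (x, y, z², zt, t²)·loc O A` (`A = k[x,z,t,y]`, `y = (z³+t⁴)/x`; the F-DP/U2 input — a HYPOTHESIS), THEN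
`tower O A 1 = loc O W`. [folklore] -/
theorem kc3_tower_one_eq_of_ca (O : ValuationSubring 𝕂) (hWO : ((𝕎 : Subalgebra k 𝕂) : Set 𝕂) ⊆ O)
    (hca : ca (loc O (𝔸 : Subalgebra k 𝕂)) =
      {c : 𝕂 | ∃ α β γ δ ε : 𝕂, α ∈ loc O (𝔸 : Subalgebra k 𝕂) ∧ β ∈ loc O (𝔸 : Subalgebra k 𝕂) ∧
        γ ∈ loc O (𝔸 : Subalgebra k 𝕂) ∧ δ ∈ loc O (𝔸 : Subalgebra k 𝕂) ∧ ε ∈ loc O (𝔸 : Subalgebra k 𝕂) ∧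
        c = α * 𝔵 + β * ((𝔷 ^ 3 + 𝔱 ^ 4) * 𝔵⁻¹) + γ * 𝔷 ^ 2 + δ * (𝔷 * 𝔱) + ε * 𝔱 ^ 2}) :
    tower O (𝔸 : Subalgebra k 𝕂) 1 = loc O (𝕎 : Subalgebra k 𝕂) :=
  PersistenceKC3TowerInstance.kc3_tower_one_eq (𝔵 : 𝕂) 𝔷 𝔱 O x_ne_zero hWO hca (nrm_loc_W_le O hWO)

end Summit.ResolutionOfSingularities.ResolutionOfSingularities.Theorems.HomologicalConductor.PersistenceKC3NormalLoc

end
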